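import Summits.ResolutionOfSingularities.ResolutionOfSingularities.Theorems.WildConesCampaignW46HypersurfacesCharTwoNearCount
import Summits.ResolutionOfSingularities.ResolutionOfSingularities.Theorems.WildConesCampaignW46HypersurfacesCharTwoHilbertThreeIff
import Summits.ResolutionOfSingularities.ResolutionOfSingularities.Theorems.WildConesCampaignW46HypersurfacesCharTwoSuccessorCorank
import Summits.ResolutionOfSingularities.ResolutionOfSingularities.Theorems.WildConesCampaignW46HypersurfacesCharTwoSatelliteExists
import Summits.ResolutionOfSingularities.ResolutionOfSingularities.Theorems.WildConesCampaignW46HypersurfacesCharTwoPairFreeCubic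
import Summits.ResolutionOfSingularities.ResolutionOfSingularities.Theorems.WildConesCampaignW46HypersurfacesCharTwoNearLocusStatement

/-!
# [OURS · L1 W4.6, rung (ii) at p = 2, every dimension] CLOSERS BY NAME of the near-locus statements
# `CampaignW46Hypersurfaces{NearCubic, NonzeroSuccessor, NearCriterion, NearCriterionOrdP, NearProjective,
# CorankOneCubic, MuTwoCubic, NearWholeKernel, CorankTwoCount} 2 n`

HONEST FRAMING. OURS: the `p = 2` instances of the nine predicates of
`Theorems/WildConesCampaignW46HypersurfacesCharTwoNearLocusStatement.lean` (seat res-L1-s46-pv-4, gen 5), proved for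
EVERY dimension `n` by the theorems of `…HypersurfacesCharTwo{CubicForm,BlowupInjective,NearLocus,NearCount}.lean`
(p523523, p524364, p524988, NearCount). The statements' explicit matrix is `polarMatrix (ser 2 n κ c)` by `rfl`.
Nothing here is a statement of the manuscript [Hironaka2017]; no FACT-LIST premise; AI review is weaker than expert
review. Cell res-hironaka (LADDER-RESOLUTION rung L, D-0089), slot W4.6; host route `WildCones`, crux
`ClassicalRegimes` (stmt-ResolutionOfSingularities-16884; proved).

REV 2 (gen 5, APPEND-ONLY: the ten rev-1 theorems are byte-identical; one import added): closers of the five rev-2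
predicates `CampaignW46Hypersurfaces{HilbertThreeCubic, HilbertThreeIffPolar, HilbertThreeWholeKernel, CubicOffKernelHilbert,
CubicOffKernelIsolated} 2 n` — the link with gen 4's `h₂` (files `…TangentCubicKernel.lean`, p530584, and `…HilbertThreeIff.lean`).

REV 3 (gen 5, APPEND-ONLY; one import added): closers of the three rev-3 predicates `CampaignW46Hypersurfaces{SuccessorCorankTwoIff,
FreePointResolved, SatelliteNear} 2 n` (file `…SuccessorCorank.lean`, p533887).

REV 4 (gen 5, APPEND-ONLY; one import added): closers of the four rev-4 predicates `CampaignW46Hypersurfaces{SatelliteUnique,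
NoSatelliteHilbertOne, SatelliteExistsHilbertTwo, SatelliteStepHilbertTwo} 2 n` (files `…SatelliteUnique.lean`, p536239, and
`…SatelliteExists.lean`).

REV 5 (gen 5, APPEND-ONLY; one import added): closers of `CampaignW46HypersurfacesPairFreeNearCubic 2 n` and `CampaignW46ThreefoldsNearDichotomy 2`
(file `…PairFreeCubic.lean`, p540046).
-/

noncomputable section

-- single-problem summit: the doubled namespace component `ResolutionOfSingularities` is forced
set_option linter.dupNamespace false

open scoped Classical

namespace Summit.ResolutionOfSingularities.ResolutionOfSingularities.Theorems

open CampaignW46.HypersurfacesCharTwo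

/-- [OURS · L1 W4.6 rung (ii), every `n`; NOT a statement of the manuscript] `CampaignW46HypersurfacesNearCubic 2 n`
holds (`hypersurface_cubic_eq_zero_of_double_successor`). [folklore] -/
theorem campaignW46HypersurfacesNearCubic_two (n : ℕ) : CampaignW46HypersurfacesNearCubic 2 n :=
  fun _ _ _ c i τ hM hM' => hypersurface_cubic_eq_zero_of_double_successor c i τ hM hM'

/-- [OURS · L1 W4.6 rung (ii), every `n`; NOT a statement of the manuscript]
`CampaignW46HypersurfacesNonzeroSuccessor 2 n` holds (`hypersurface_ser_step_ne_zero`). [folklore] -/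
theorem campaignW46HypersurfacesNonzeroSuccessor_two (n : ℕ) : CampaignW46HypersurfacesNonzeroSuccessor 2 n :=
  fun _ _ _ c i τ hM hI => hypersurface_ser_step_ne_zero c i τ hM hI

/-- [OURS · L1 W4.6 rung (ii), every `n`, every corank; NOT a statement of the manuscript]
`CampaignW46HypersurfacesNearCriterion 2 n` holds: THE NEAR-POINT CRITERION (`hypersurface_multP_step_iff`).
[cite: GreuelPfister2026, Thm 3.5 and Cor 3.7] -/
theorem campaignW46HypersurfacesNearCriterion_two (n : ℕ) : CampaignW46HypersurfacesNearCriterion 2 n :=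
  fun _ _ _ c i τ hM hI => hypersurface_multP_step_iff c i τ hM hI

/-- [OURS · L1 W4.6 rung (ii), every `n`; NOT a statement of the manuscript]
`CampaignW46HypersurfacesNearCriterionOrdP 2 n` holds (`hypersurface_multP_step_iff_of_ordP`). [folklore] -/
theorem campaignW46HypersurfacesNearCriterionOrdP_two (n : ℕ) : CampaignW46HypersurfacesNearCriterionOrdP 2 n :=
  fun _ _ _ c i τ hM hO => hypersurface_multP_step_iff_of_ordP c i τ hM hO

/-- [OURS · L1 W4.6 rung (ii), every `n`; NOT a statement of the manuscript]
`CampaignW46HypersurfacesNearProjective 2 n` holds (`hypersurface_multP_step_rescale`). [folklore] -/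
theorem campaignW46HypersurfacesNearProjective_two (n : ℕ) : CampaignW46HypersurfacesNearProjective 2 n :=
  fun _ _ _ c i i' τ hM hI hM' hw => hypersurface_multP_step_rescale c i i' τ hM hI hM' hw

/-- [OURS · L1 W4.6 rung (ii), every `n`; NOT a statement of the manuscript]
`CampaignW46HypersurfacesCorankOneCubic 2 n` holds (`hypersurface_exists_double_successor_iff_cubic`). [folklore] -/
theorem campaignW46HypersurfacesCorankOneCubic_two (n : ℕ) : CampaignW46HypersurfacesCorankOneCubic 2 n :=
  fun _ _ _ c _ hM hI he hw₀ hker₀ => hypersurface_exists_double_successor_iff_cubic c hM hI he hw₀ hker₀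

/-- [OURS · L1 W4.6 rung (ii), every `n ≥ 3`; NOT a statement of the manuscript]
`CampaignW46HypersurfacesMuTwoCubic 2 n` holds (`hypersurface_mu_eq_two_iff_cubic_ne_zero`).
[cite: GreuelPfister2026, Thm 3.5 and Cor 3.7] -/
theorem campaignW46HypersurfacesMuTwoCubic_two (n : ℕ) : CampaignW46HypersurfacesMuTwoCubic 2 n :=
  fun hn _ _ _ c _ hM hI he hw₀ hker₀ => hypersurface_mu_eq_two_iff_cubic_ne_zero hn c hM hI he hw₀ hker₀

/-- [OURS · L1 W4.6 rung (ii), every `n`, every corank; NOT a statement of the manuscript]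
`CampaignW46HypersurfacesNearWholeKernel 2 n` holds (`hypersurface_nearPoints_whole_kernel_iff`). [folklore] -/
theorem campaignW46HypersurfacesNearWholeKernel_two (n : ℕ) : CampaignW46HypersurfacesNearWholeKernel 2 n :=
  fun _ _ _ c hM hI => hypersurface_nearPoints_whole_kernel_iff c hM hI

/-- [OURS · L1 W4.6 rung (ii), every `n`; NOT a statement of the manuscript]
`CampaignW46HypersurfacesCorankTwoCount 2 n` holds: at most three infinitely-near double points in corank two
unless the tangent cubic vanishes on the kernel plane (`hypersurface_nearPoints_le_three`). [cite: CasasAlvero2000, §3] -/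
theorem campaignW46HypersurfacesCorankTwoCount_two (n : ℕ) : CampaignW46HypersurfacesCorankTwoCount 2 n :=
  fun _ _ _ c hM hI he hcub => hypersurface_nearPoints_le_three c hM hI he hcub

/-- [OURS · L1 W4.6 rung (ii); NOT a statement of the manuscript] The nine near-locus predicates at `p = 2`, every
dimension at once. [folklore] -/
theorem campaignW46HypersurfacesNearLocus_two_all :
    (∀ n, CampaignW46HypersurfacesNearCubic 2 n) ∧ (∀ n, CampaignW46HypersurfacesNonzeroSuccessor 2 n) ∧
      (∀ n, CampaignW46HypersurfacesNearCriterion 2 n) ∧ (∀ n, CampaignW46HypersurfacesNearCriterionOrdP 2 n) ∧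
      (∀ n, CampaignW46HypersurfacesNearProjective 2 n) ∧ (∀ n, CampaignW46HypersurfacesCorankOneCubic 2 n) ∧
      (∀ n, CampaignW46HypersurfacesMuTwoCubic 2 n) ∧ (∀ n, CampaignW46HypersurfacesNearWholeKernel 2 n) ∧
      (∀ n, CampaignW46HypersurfacesCorankTwoCount 2 n) :=
  ⟨campaignW46HypersurfacesNearCubic_two, campaignW46HypersurfacesNonzeroSuccessor_two,
    campaignW46HypersurfacesNearCriterion_two, campaignW46HypersurfacesNearCriterionOrdP_two,
    campaignW46HypersurfacesNearProjective_two, campaignW46HypersurfacesCorankOneCubic_two,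
    campaignW46HypersurfacesMuTwoCubic_two, campaignW46HypersurfacesNearWholeKernel_two,
    campaignW46HypersurfacesCorankTwoCount_two⟩


/-- [OURS · L1 W4.6 rung (ii), every `n`; rev 2; NOT a statement of the manuscript]
`CampaignW46HypersurfacesHilbertThreeCubic 2 n` holds (`hypersurface_cubic_eq_zero_of_milnorHilbertTwo_eq_three`). [folklore] -/
theorem campaignW46HypersurfacesHilbertThreeCubic_two (n : ℕ) : CampaignW46HypersurfacesHilbertThreeCubic 2 n :=
  fun _ _ _ c _ hM he hh hw => hypersurface_cubic_eq_zero_of_milnorHilbertTwo_eq_three c hM he hh hw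

/-- [OURS · L1 W4.6 rung (ii), every `n`; rev 2; NOT a statement of the manuscript]
`CampaignW46HypersurfacesHilbertThreeIffPolar 2 n` holds: at corank two, `h₂ = 3` iff the tangent cubic is the zero form on
the kernel plane (`hypersurface_milnorHilbertTwo_eq_three_iff_polar`). [folklore] -/
theorem campaignW46HypersurfacesHilbertThreeIffPolar_two (n : ℕ) : CampaignW46HypersurfacesHilbertThreeIffPolar 2 n :=
  fun _ _ _ c hM he => hypersurface_milnorHilbertTwo_eq_three_iff_polar c hM he

/-- [OURS · L1 W4.6 rung (ii), every `n`; rev 2; NOT a statement of the manuscript]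
`CampaignW46HypersurfacesHilbertThreeWholeKernel 2 n` holds (`hypersurface_whole_kernel_near_of_milnorHilbertTwo_eq_three`).
[folklore] -/
theorem campaignW46HypersurfacesHilbertThreeWholeKernel_two (n : ℕ) :
    CampaignW46HypersurfacesHilbertThreeWholeKernel 2 n :=
  fun _ _ _ c _ _ hM hI he hh hw hwi => hypersurface_whole_kernel_near_of_milnorHilbertTwo_eq_three c hM hI he hh hw hwi

/-- [OURS · L1 W4.6 rung (ii), every `n`; rev 2; NOT a statement of the manuscript]
`CampaignW46HypersurfacesCubicOffKernelHilbert 2 n` holds (`hypersurface_milnorHilbertTwo_le_two_of_cubic_ne_zero`). [folklore] -/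
theorem campaignW46HypersurfacesCubicOffKernelHilbert_two (n : ℕ) : CampaignW46HypersurfacesCubicOffKernelHilbert 2 n :=
  fun _ _ _ c _ hM he hv hcub => hypersurface_milnorHilbertTwo_le_two_of_cubic_ne_zero c hM he hv hcub

/-- [OURS · L1 W4.6 rung (ii), every `n`; rev 2; NOT a statement of the manuscript]
`CampaignW46HypersurfacesCubicOffKernelIsolated 2 n` holds: a kernel vector off the tangent cubic gives at most three near double
points, all isolated with smaller Milnor number (`hypersurface_nearPoints_le_three_isolated`). [folklore] -/
theorem campaignW46HypersurfacesCubicOffKernelIsolated_two (n : ℕ) : CampaignW46HypersurfacesCubicOffKernelIsolated 2 n :=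
  fun _ _ _ c _ hM hI he hv hcub => hypersurface_nearPoints_le_three_isolated c hM hI he hv hcub

/-- [OURS · L1 W4.6 rung (ii); rev 2; NOT a statement of the manuscript] The five rev-2 predicates at `p = 2`, every dimension at
once. [folklore] -/
theorem campaignW46HypersurfacesNearLocus_two_all' :
    (∀ n, CampaignW46HypersurfacesHilbertThreeCubic 2 n) ∧ (∀ n, CampaignW46HypersurfacesHilbertThreeIffPolar 2 n) ∧
      (∀ n, CampaignW46HypersurfacesHilbertThreeWholeKernel 2 n) ∧ (∀ n, CampaignW46HypersurfacesCubicOffKernelHilbert 2 n) ∧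
      (∀ n, CampaignW46HypersurfacesCubicOffKernelIsolated 2 n) :=
  ⟨campaignW46HypersurfacesHilbertThreeCubic_two, campaignW46HypersurfacesHilbertThreeIffPolar_two,
    campaignW46HypersurfacesHilbertThreeWholeKernel_two, campaignW46HypersurfacesCubicOffKernelHilbert_two,
    campaignW46HypersurfacesCubicOffKernelIsolated_two⟩


/-- [OURS · L1 W4.6 rung (ii), every `n`; rev 3; NOT a statement of the manuscript]
`CampaignW46HypersurfacesSuccessorCorankTwoIff 2 n` holds: the successor's corank at a near point of a corank-two double point is `2`
iff the point is singular on the kernel cubic (`hypersurface_milnorEmbDim_step_eq_two_iff`). [folklore] -/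
theorem campaignW46HypersurfacesSuccessorCorankTwoIff_two (n : ℕ) : CampaignW46HypersurfacesSuccessorCorankTwoIff 2 n :=
  fun _ _ _ c i τ hM he hM' => hypersurface_milnorEmbDim_step_eq_two_iff c i τ hM he hM'

/-- [OURS · L1 W4.6 rung (ii), every `n`; rev 3; NOT a statement of the manuscript]
`CampaignW46HypersurfacesFreePointResolved 2 n` holds (`hypersurface_simple_tangent_resolved`). [folklore] -/
theorem campaignW46HypersurfacesFreePointResolved_two (n : ℕ) : CampaignW46HypersurfacesFreePointResolved 2 n :=
  fun _ _ _ c i τ _ hM he hM' hv hne => hypersurface_simple_tangent_resolved c i τ hM he hM' hv hne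

/-- [OURS · L1 W4.6 rung (ii), every `n`; rev 3; NOT a statement of the manuscript]
`CampaignW46HypersurfacesSatelliteNear 2 n` holds (`hypersurface_singular_direction_corank_two`). [folklore] -/
theorem campaignW46HypersurfacesSatelliteNear_two (n : ℕ) : CampaignW46HypersurfacesSatelliteNear 2 n :=
  fun _ _ _ c _ _ hM hI he hli hlam hsing => hypersurface_singular_direction_corank_two c hM hI he hli hlam hsing

/-- [OURS · L1 W4.6 rung (ii); rev 3; NOT a statement of the manuscript] The three rev-3 predicates at `p = 2`, every dimension at
once. [folklore] -/
theorem campaignW46HypersurfacesNearLocus_two_all'' :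
    (∀ n, CampaignW46HypersurfacesSuccessorCorankTwoIff 2 n) ∧ (∀ n, CampaignW46HypersurfacesFreePointResolved 2 n) ∧
      (∀ n, CampaignW46HypersurfacesSatelliteNear 2 n) :=
  ⟨campaignW46HypersurfacesSuccessorCorankTwoIff_two, campaignW46HypersurfacesFreePointResolved_two,
    campaignW46HypersurfacesSatelliteNear_two⟩


/-- [OURS · L1 W4.6 rung (ii), every `n`; rev 4; NOT a statement of the manuscript] `CampaignW46HypersurfacesSatelliteUnique 2 n`
holds: at most one satellite (`hypersurface_satellite_unique`). [folklore] -/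
theorem campaignW46HypersurfacesSatelliteUnique_two (n : ℕ) : CampaignW46HypersurfacesSatelliteUnique 2 n :=
  fun _ _ _ c _ _ hM he hh hw₁0 hw₁ hw₂ hs₁ hs₂ => hypersurface_satellite_unique c hM he hh hw₁0 hw₁ hw₂ hs₁ hs₂

/-- [OURS · L1 W4.6 rung (ii), every `n`; rev 4; NOT a statement of the manuscript] `CampaignW46HypersurfacesNoSatelliteHilbertOne 2 n`
holds (`hypersurface_no_satellite_of_milnorHilbertTwo_eq_one`). [folklore] -/
theorem campaignW46HypersurfacesNoSatelliteHilbertOne_two (n : ℕ) : CampaignW46HypersurfacesNoSatelliteHilbertOne 2 n :=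
  fun _ _ _ c _ hM hI he hh hlam hsing => hypersurface_no_satellite_of_milnorHilbertTwo_eq_one c hM hI he hh hlam hsing

/-- [OURS · L1 W4.6 rung (ii), every `n`, perfect field; rev 4; NOT a statement of the manuscript]
`CampaignW46HypersurfacesSatelliteExistsHilbertTwo 2 n` holds: at `h₂ = 2` over a perfect field the satellite direction exists
(`hypersurface_exists_satellite_of_milnorHilbertTwo_eq_two`). [folklore] -/
theorem campaignW46HypersurfacesSatelliteExistsHilbertTwo_two (n : ℕ) : CampaignW46HypersurfacesSatelliteExistsHilbertTwo 2 n :=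
  fun _ _ _ _ c hM he hh => hypersurface_exists_satellite_of_milnorHilbertTwo_eq_two c hM he hh

/-- [OURS · L1 W4.6 rung (ii), every `n`, perfect field; rev 4; NOT a statement of the manuscript]
`CampaignW46HypersurfacesSatelliteStepHilbertTwo 2 n` holds: the `(2,2)` class continues the corank-two chain at one isolated point
(`hypersurface_satellite_step_of_milnorHilbertTwo_eq_two`). [folklore] -/
theorem campaignW46HypersurfacesSatelliteStepHilbertTwo_two (n : ℕ) : CampaignW46HypersurfacesSatelliteStepHilbertTwo 2 n :=
  fun _ _ _ _ c hM hI he hh => hypersurface_satellite_step_of_milnorHilbertTwo_eq_two c hM hI he hh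

/-- [OURS · L1 W4.6 rung (ii); rev 4; NOT a statement of the manuscript] The four rev-4 predicates at `p = 2`, every dimension at once.
[folklore] -/
theorem campaignW46HypersurfacesNearLocus_two_all_rev4 :
    (∀ n, CampaignW46HypersurfacesSatelliteUnique 2 n) ∧ (∀ n, CampaignW46HypersurfacesNoSatelliteHilbertOne 2 n) ∧
      (∀ n, CampaignW46HypersurfacesSatelliteExistsHilbertTwo 2 n) ∧ (∀ n, CampaignW46HypersurfacesSatelliteStepHilbertTwo 2 n) :=
  ⟨campaignW46HypersurfacesSatelliteUnique_two, campaignW46HypersurfacesNoSatelliteHilbertOne_two,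
    campaignW46HypersurfacesSatelliteExistsHilbertTwo_two, campaignW46HypersurfacesSatelliteStepHilbertTwo_two⟩


/-- [OURS · L1 W4.6 rung (ii), every `n`; rev 5; NOT a statement of the manuscript] `CampaignW46HypersurfacesPairFreeNearCubic 2 n`
holds (`hypersurface_multP_step_iff_cubic_of_not_ordP`). [folklore] -/
theorem campaignW46HypersurfacesPairFreeNearCubic_two (n : ℕ) : CampaignW46HypersurfacesPairFreeNearCubic 2 n :=
  fun _ _ _ c i τ hM hI hO => hypersurface_multP_step_iff_cubic_of_not_ordP c i τ hM hI hO

/-- [OURS · L1 W4.6 rung (ii), threefolds; rev 5; NOT a statement of the manuscript] `CampaignW46ThreefoldsNearDichotomy 2` holds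
(`threefold_near_dichotomy`). [folklore] -/
theorem campaignW46ThreefoldsNearDichotomy_two : CampaignW46ThreefoldsNearDichotomy 2 :=
  fun _ _ _ c hM hI => threefold_near_dichotomy c hM hI

end Summit.ResolutionOfSingularities.ResolutionOfSingularities.Theorems

end
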